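import Mathlib.Tactic.Sat.FromLRAT
import HarnessLib

/-!
# Explicit-index CNF encoding of the `k = 1` CSS normal form + LRAT replay wrapper (KERNEL-PLAN items 1′/4)

LADDER-QEC (venture cell `qec`), kernel-closure plan for the css-n16 cell `(16,1)` (census/type-02/css161/KERNEL-PLAN.md).
The `k = 1` normal form (`Census/CSSNormalFormK1.lean`, `exists_normalForm`) reduces «∃ CSS [[n,1,≥ d]] with `rank H^Z = b`» to
the existence of `P ∈ 𝔽₂^{b×m}` (`m = n − b`) and `w ∈ [d, m]` with, for `s = 1^w0^{m−w}`, `(Z) ∀ v, wt v + wt (vP + s) ≥ d` and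
`(X) ∀ u, ⟨u,s⟩ = 1 → wt u + wt (P uᵀ) ≥ d`. This file DEFINES the CNF `NFEnc.cnf ⟨n,d,b,w⟩` whose satisfying assignments are
exactly the matrices `P` (bits `pv i j`) satisfying `(Z)`, `(X)` and the double-lex symmetry-breaking normal form (rows
nondecreasing as integers, bit `m−1` most significant; inside `S = [0,w)` and inside `S^c`: `col_{j+1} ≤_lex col_j`), with
EXPLICIT auxiliary-variable indices (module docstring of the core twin HOME/lean/type-02/gen6/kernel161/EncodeCore.lean):
`zv t j` = `s_j ⊕ ⊕_{i∈V_t} P i j` for the `t`-th row set `V_t` (sizes `1 … d−1`), `xv t i` = `⊕_{j∈U_t} P i j` for the `t`-th column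
set with `|U_t ∩ S|` odd, `ev q k` = equal-prefix auxiliaries of the `q`-th lex chain. Clause families: XOR definitions
(`xorClauses`: forbid the wrong-parity assignments), «weight ≥ t» (`atLeast`: every `(len − t + 1)`-subset has a true literal), lex
chains (`lexClauses`). The same code, run locally with `lean --run` (core Lean only), produced the DIMACS files that CaDiCaL 2.1.2
refuted with LRAT proofs (census/type-02/css161/sat2/); the instance files `UnsatB<b>W<w>.lean` pass `NFEnc.dimacs c []` and the
LRAT text (String chunks `LratB<b>W<w>C<i>.lean`) to Mathlib's `lrat_proof` command, whose private core theorem `….proof_k :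
Sat.Fmla.proof <parsed formula> []` is re-exported there as `unsat_nf16_b<b>_w<w> : Sat.Fmla.proof (NFEnc.fmla c) Sat.Clause.nil` (the kernel
checks that the parsed formula is definitionally `NFEnc.fmla c`; axioms `[propext]`). Soundness of the encoding w.r.t. `(Z)`, `(X)` is the sibling file
`EncodeSound.lean` (to come); this file has definitions and small sanity checks only.
-/

set_option autoImplicit false

namespace Summit.Ventures.QEC.Census.CSSNormalFormSAT

namespace NFEnc


/-- lexicographic k-subsets of [lo,n) -/
def combosFrom : Nat → Nat → Nat → Nat → List (List Nat)
  | _, _, _, 0 => [[]]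
  | 0, _, _, _ + 1 => []
  | fuel + 1, lo, n, k + 1 =>
    if n < lo + (k + 1) then []
    else (combosFrom fuel (lo + 1) n k).map (lo :: ·) ++ combosFrom fuel (lo + 1) n (k + 1)

/-- `combos` — see the module docstring (explicit-index k = 1 normal-form CNF). (definition) -/
def combos (n k : Nat) : List (List Nat) := combosFrom n 0 n k

/-- all row sets V_t: sizes 1..d-1, each size lexicographic -/
def rowSets (d b : Nat) : List (List Nat) :=
  (List.range (d - 1)).flatMap fun t => combos b (t + 1)

/-- all column sets U_t: sizes 1..d-1 with |U ∩ [0,w)| odd -/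
def colSets (d m w : Nat) : List (List Nat) :=
  (List.range (d - 1)).flatMap fun t => (combos m (t + 1)).filter fun u => (u.filter (· < w)).length % 2 == 1

/-- `bitstrings` — see the module docstring (explicit-index k = 1 normal-form CNF). (definition) -/
def bitstrings : Nat → List (List Bool)
  | 0 => [[]]
  | k + 1 => (bitstrings k).map (false :: ·) ++ (bitstrings k).map (true :: ·)

/-- `parity` — see the module docstring (explicit-index k = 1 normal-form CNF). (definition) -/
def parity : List Bool → Bool
  | [] => false
  | x :: xs => xor x (parity xs)

/-- `Cfg` — see the module docstring (explicit-index k = 1 normal-form CNF). (definition) -/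
structure Cfg where
  n : Nat
  d : Nat
  b : Nat
  w : Nat
deriving Repr

namespace Cfg
/-- `m` — see the module docstring (explicit-index k = 1 normal-form CNF). (definition) -/
def m (c : Cfg) : Nat := c.n - c.b
/-- `NZ` — see the module docstring (explicit-index k = 1 normal-form CNF). (definition) -/
def NZ (c : Cfg) : Nat := (rowSets c.d c.b).length
/-- `NX` — see the module docstring (explicit-index k = 1 normal-form CNF). (definition) -/
def NX (c : Cfg) : Nat := (colSets c.d c.m c.w).length
/-- `L` — see the module docstring (explicit-index k = 1 normal-form CNF). (definition) -/
def L (c : Cfg) : Nat := max c.m c.b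
/-- `pv` — see the module docstring (explicit-index k = 1 normal-form CNF). (definition) -/
def pv (c : Cfg) (i j : Nat) : Int := Int.ofNat (1 + i * c.m + j)
/-- `zv` — see the module docstring (explicit-index k = 1 normal-form CNF). (definition) -/
def zv (c : Cfg) (t j : Nat) : Int := Int.ofNat (1 + c.b * c.m + t * c.m + j)
/-- `xv` — see the module docstring (explicit-index k = 1 normal-form CNF). (definition) -/
def xv (c : Cfg) (t i : Nat) : Int := Int.ofNat (1 + c.b * c.m + c.NZ * c.m + t * c.b + i)
/-- `ev` — see the module docstring (explicit-index k = 1 normal-form CNF). (definition) -/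
def ev (c : Cfg) (q k : Nat) : Int := Int.ofNat (1 + c.b * c.m + c.NZ * c.m + c.NX * c.b + q * c.L + k)
/-- number of lex constraints: (b-1) row pairs + (w-1) S-column pairs + (c-1) S^c-column pairs -/
def NQ (c : Cfg) : Nat := (c.b - 1) + (c.w - 1) + (c.m - c.w - 1)
/-- `nvars` — see the module docstring (explicit-index k = 1 normal-form CNF). (definition) -/
def nvars (c : Cfg) : Nat := c.b * c.m + c.NZ * c.m + c.NX * c.b + c.NQ * c.L
end Cfg

/-- clause forbidding the assignment `bits` of `vars`: ⋁ (¬v if bit else v) -/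
def forbid : List Int → List Bool → List Int
  | v :: vs, bt :: bs => (if bt then -v else v) :: forbid vs bs
  | _, _ => []

/-- clauses defining `z = const ⊕ ⊕ lits` (all on the variable list lits ++ [z]) -/
def xorClauses (lits : List Int) (z : Int) (const : Bool) : List (List Int) :=
  let vs := lits ++ [z]
  (bitstrings vs.length).filterMap fun bits => if parity bits != const then some (forbid vs bits) else none

/-- «at least t of zs are true»: every (len - t + 1)-subset contains a true one (t = 0: none; t > len: empty clause) -/
def atLeast (zs : List Int) (t : Nat) : List (List Int) :=
  if t = 0 then [] else if zs.length < t then [[]]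
  else (combos zs.length (zs.length - t + 1)).map fun Z0 => Z0.map fun j => zs.getD j 0

/-- lex chain xs ≤_lex ys (most significant first) with auxiliaries e_0 … e_{len-1} = es -/
def lexClauses : List Int → List Int → List Int → List (List Int)
  | x :: xs, y :: ys, e :: es =>
    let here := [[-e, -x, y]]
    let link := match xs, es with
      | _ :: _, e2 :: _ => [[-e, -x, e2], [-e, y, e2]]
      | _, _ => []
    here ++ link ++ lexClauses xs ys es
  | _, _, _ => []

/-- the (Z) family -/
def zClauses (c : Cfg) : List (List Int) :=
  ((rowSets c.d c.b).zipIdx).flatMap fun (v, t) =>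
    let defs := (List.range c.m).flatMap fun j => xorClauses (v.map fun i => c.pv i j) (c.zv t j) (decide (j < c.w))
    defs ++ atLeast ((List.range c.m).map fun j => c.zv t j) (c.d - v.length)

/-- the (X) family -/
def xClauses (c : Cfg) : List (List Int) :=
  ((colSets c.d c.m c.w).zipIdx).flatMap fun (u, t) =>
    let defs := (List.range c.b).flatMap fun i => xorClauses (u.map fun j => c.pv i j) (c.xv t i) false
    defs ++ atLeast ((List.range c.b).map fun i => c.xv t i) (c.d - u.length)

/-- the q-th lex constraint: unit [e_0] then the chain -/
def lexBlock (c : Cfg) (q : Nat) (xs ys : List Int) : List (List Int) :=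
  let es := (List.range xs.length).map fun k => c.ev q k
  [[c.ev q 0]] ++ lexClauses xs ys es

/-- symmetry-breaking family: rows nondecreasing (bit m-1 most significant); inside S and inside S^c: col_{j+1} ≤_lex col_j -/
def symClauses (c : Cfg) : List (List Int) :=
  let rowC := (List.range (c.b - 1)).flatMap fun i =>
    lexBlock c i (((List.range c.m).reverse).map fun j => c.pv i j) (((List.range c.m).reverse).map fun j => c.pv (i + 1) j)
  let colC := fun (q0 lo hi : Nat) => (List.range (hi - lo - 1)).flatMap fun t =>
    let j := lo + t
    lexBlock c (q0 + t) ((List.range c.b).map fun i => c.pv i (j + 1)) ((List.range c.b).map fun i => c.pv i j)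
  rowC ++ colC (c.b - 1) 0 c.w ++ colC (c.b - 1 + (c.w - 1)) c.w c.m

/-- the whole CNF (symmetry-broken) -/
def cnf (c : Cfg) : List (List Int) := symClauses c ++ zClauses c ++ xClauses c

/-- `dimacs` — see the module docstring (explicit-index k = 1 normal-form CNF). (definition) -/
def dimacs (c : Cfg) (extra : List (List Int)) : String :=
  let cls := cnf c ++ extra
  let hdr := s!"p cnf {c.nvars} {cls.length}\n"
  cls.foldl (fun acc cl => acc ++ (cl.foldl (fun a (l : Int) => a ++ toString l ++ " ") "") ++ "0\n") hdr


/-- The CNF as a `Sat.Fmla` (Mathlib's LRAT-replay vocabulary): clause lists of `Sat.Literal.ofInt`. (definition) -/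
def fmla (c : Cfg) : Sat.Fmla := (cnf c).map fun cl => cl.map Sat.Literal.ofInt

end NFEnc

/-! ## Sanity checks -/

/-- `combos 4 2` in `itertools.combinations` order. -/
example : NFEnc.combos 4 2 = [[0,1],[0,2],[0,3],[1,2],[1,3],[2,3]] := by decide

/-- The (16,5,8,5) instance has 2104 variables (= the DIMACS header CaDiCaL refuted). -/
example : (⟨16, 5, 8, 5⟩ : NFEnc.Cfg).nvars = 2104 := by decide +kernel

end Summit.Ventures.QEC.Census.CSSNormalFormSAT
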